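import Mathlib
import Summits.NavierStokesRegularity.NavierStokesRegularity.Theorems.LerayQuarterDissipationFiniteDissipationLiouvilleWindowVolumeScaling
import HarnessLib

/-!
# Crux `FiniteDissipationLiouville` (stmt-NavierStokesRegularity-22144): THE SUPER-SELF-SIMILAR
# INSTANTS OCCUPY A DEFINITE FRACTION OF EVERY BACKWARD WINDOW

Theorems file of route `LerayQuarterDissipation` (lead prover g19; `--supports` the crux; sequel of
`…WindowVolumeScaling`). Navier–Stokes regularity is NOT proved by anything here; no summit is.

`…WindowVolumeScaling.speed_exceeds_one_volume_core`: for a singular KNSS-gauge Type-I field with a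
Type-I envelope (constant `A`), at every scale `c` the fast set `{√(−t)‖u‖ > 1}` meets the window
`[−c², −εc²] × ℝ³` in volume `≥ η(A) c⁵` and lies in the parabolic core `{‖x‖ < (A−1)√(−t)}`, whose
slices in that window are balls of radius `≤ (A−1)c`. Cavalieri (the product structure of Lebesgue
measure on `ℝ × ℝ³`, `Measure.prod_prod`, and `addHaar_ball`) turns this into a statement about TIMES:

* `one_lt_of_singular_envelope` — a singular enveloped field has envelope constant `A > 1`
  (there is a fast point, and fast points have `‖x‖ < (A−1)√(−t)`);
* **`fastTimes_measure_ge`** — THE TEMPORAL DENSITY OF SUPER-SELF-SIMILAR INSTANTS: for every `A`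
  there are `ε = ε(A) ∈ (0,1)` and `κ = κ(A) > 0` such that for every SINGULAR KNSS-gauge Type-I
  field (`IsTypeIAncientMild C V`, `C ≤ A`) with a Type-I envelope `HasTypeIDecay A V` and every
  `c > 0`, the set of instants `t ∈ [−c², −εc²]` at which SOME point is super-self-similar,
  `√(−t)‖V(t,x)‖ > 1`, has Lebesgue measure `≥ κ c²` — a definite, scale-independent FRACTION
  `κ/(1−ε)` of every backward window, at every scale, down to the apex and back to `−∞`.

For the critical element of the crux (enveloped by `…Envelope`) this reads: the hypothetical
minimal Type-I blow-up profile spends a definite fraction of (logarithmic) time above the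
self-similar speed threshold — it cannot idle below threshold one except on a time set of density
`≤ 1 − κ/(1−ε)` in any window.

HONEST FRAMING. Cavalieri bookkeeping on top of the compactness corollaries of `…WindowRecurrence`;
`ε, η, κ` ineffective; statements about a HYPOTHETICAL object. Nothing is removed from the DSS wall
(`∀ c>1 TypeIDSSLiouville c`, NECESSARY for the crux). Nothing here bears on NS regularity.

References: Koch–Nadirashvili–Seregin–Šverák, Acta Math. 203 (2009) §4; folklore.
-/

noncomputable section

set_option linter.dupNamespace false

namespace Summit.NavierStokesRegularity.NavierStokesRegularity.Theorems.FiniteDissipationLiouville.WindowRecurrence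

open MeasureTheory Set Filter Topology Metric InnerProductSpace Function Real
open scoped RealInnerProductSpace ContDiff ENNReal
open Literature.Analysis Literature.Analysis.FluidPDE
open Summit.NavierStokesRegularity.NavierStokesRegularity.Theorems
open Summit.NavierStokesRegularity.NavierStokesRegularity.Theorems.RecurrentReductionD
open Summit.NavierStokesRegularity.NavierStokesRegularity.Theorems.FiniteDissipationLiouville
open Summit.NavierStokesRegularity.NavierStokesRegularity.Theorems.FiniteDissipationLiouville.CrossFlow
open Summit.NavierStokesRegularity.NavierStokesRegularity.Theorems.FiniteDissipationLiouville.WindowSocket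

/-! ### Cavalieri on the window -/

section Cavalieri

/-- **The fast part of a window lies in a product**: `{(t,x) : t ∈ [−c², −εc²], ‖x‖ < (A−1)√(−t)}`
is contained in `(fast times) × B(0, (A−1)c)` — more precisely, any subset of the window whose
points satisfy `‖x‖ < (A−1)√(−t)` lies in `T ×ˢ ball 0 ((A−1)c)` where `T` is its time projection.
[folklore] -/
theorem subset_times_prod_ball {A c ε : ℝ} (hc : 0 < c) (hA : 1 < A)
    {V : ℝ → EuclideanSpace ℝ (Fin 3) → EuclideanSpace ℝ (Fin 3)}
    (hcore : {p : ℝ × EuclideanSpace ℝ (Fin 3) | p.1 ∈ Icc (-c ^ 2) (-(ε * c ^ 2)) ∧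
        1 < Real.sqrt (-p.1) * ‖V p.1 p.2‖} ⊆
      {p : ℝ × EuclideanSpace ℝ (Fin 3) | p.1 ∈ Icc (-c ^ 2) (-(ε * c ^ 2)) ∧
        ‖p.2‖ < (A - 1) * Real.sqrt (-p.1)}) :
    {p : ℝ × EuclideanSpace ℝ (Fin 3) | p.1 ∈ Icc (-c ^ 2) (-(ε * c ^ 2)) ∧
        1 < Real.sqrt (-p.1) * ‖V p.1 p.2‖} ⊆
      {t : ℝ | t ∈ Icc (-c ^ 2) (-(ε * c ^ 2)) ∧ ∃ x, 1 < Real.sqrt (-t) * ‖V t x‖} ×ˢ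
        ball (0 : EuclideanSpace ℝ (Fin 3)) ((A - 1) * c) := by
  intro p hp
  refine ⟨⟨hp.1, p.2, hp.2⟩, ?_⟩
  have h := (hcore hp).2
  rw [mem_ball_zero_iff]
  refine h.trans_le (mul_le_mul_of_nonneg_left ?_ (by linarith))
  -- `√(−t) ≤ c` on the window
  have h1 : -p.1 ≤ c ^ 2 := by linarith [hp.1.1]
  calc Real.sqrt (-p.1) ≤ Real.sqrt (c ^ 2) := Real.sqrt_le_sqrt h1
    _ = c := Real.sqrt_sq hc.le

/-- Volume of a ball of radius `r > 0` in `ℝ³`: `r³ · vol B(0,1)`. [folklore] -/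
theorem volume_ball_eq {r : ℝ} (hr : 0 < r) :
    volume (ball (0 : EuclideanSpace ℝ (Fin 3)) r) =
      ENNReal.ofReal (r ^ 3) * volume (ball (0 : EuclideanSpace ℝ (Fin 3)) 1) := by
  rw [Measure.addHaar_ball_of_pos volume (0 : EuclideanSpace ℝ (Fin 3)) hr, finrank_euclideanSpace,
    Fintype.card_fin]

/-- **Cavalieri bound**: a subset of `T ×ˢ B(0,R)` of volume `≥ η c⁵` forces
`vol₁(T) · R³ b₃ ≥ η c⁵`. In the form used below: if `vol(S) ≥ ofReal m` and `S ⊆ T ×ˢ ball 0 R`,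
`R > 0`, then `ofReal m ≤ vol₁(T) * ofReal (R³ b₃)`. [folklore] -/
theorem measure_times_mul_ge {S : Set (ℝ × EuclideanSpace ℝ (Fin 3))} {T : Set ℝ} {R m : ℝ}
    (hR : 0 < R) (hsub : S ⊆ T ×ˢ ball (0 : EuclideanSpace ℝ (Fin 3)) R)
    (hm : ENNReal.ofReal m ≤ volume S) :
    ENNReal.ofReal m ≤ volume T *
      ENNReal.ofReal (R ^ 3 * (volume (ball (0 : EuclideanSpace ℝ (Fin 3)) 1)).toReal) := by
  have h1 : volume S ≤ volume (T ×ˢ ball (0 : EuclideanSpace ℝ (Fin 3)) R) := measure_mono hsub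
  rw [Measure.volume_eq_prod, Measure.prod_prod, volume_ball_eq hR] at h1
  rw [ENNReal.ofReal_mul (by positivity), ENNReal.ofReal_toReal measure_ball_lt_top.ne, ← mul_assoc]
  calc ENNReal.ofReal m ≤ volume S := hm
    _ ≤ _ := h1
    _ = _ := by rw [mul_assoc]

end Cavalieri

/-! ### The temporal density of super-self-similar instants -/

section FastTimes

/-- **A singular enveloped field has envelope constant `A > 1`.** [folklore] -/
theorem one_lt_of_singular_envelope {A C : ℝ} {V : ℝ → EuclideanSpace ℝ (Fin 3) → EuclideanSpace ℝ (Fin 3)}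
    (hV : IsTypeIAncientMild C V) (hCA : C ≤ A) (hdec : HasTypeIDecay A V)
    (hsing : ∀ r > 0, ∀ M : ℝ, ∃ t ∈ Ioo (-(r ^ 2)) (0 : ℝ),
      ∃ x ∈ ball (0 : EuclideanSpace ℝ (Fin 3)) r, M < ‖V t x‖) : 1 < A := by
  obtain ⟨ε, hε, -, h⟩ := speed_exceeds_one_in_every_window A
  obtain ⟨t, ht, x, hx⟩ := h C V hV hCA hdec hsing 1 one_pos
  have ht0 : t < 0 := by
    have : 0 < ε * (1:ℝ) ^ 2 := by positivity
    linarith [ht.2]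
  have h1 := norm_lt_of_fast hdec ht0 hx
  have hs : 0 < Real.sqrt (-t) := Real.sqrt_pos.2 (neg_pos.2 ht0)
  by_contra hA
  have : (A - 1) * Real.sqrt (-t) ≤ 0 := mul_nonpos_of_nonpos_of_nonneg (by linarith) hs.le
  linarith [norm_nonneg x]

/-- **THE TEMPORAL DENSITY OF SUPER-SELF-SIMILAR INSTANTS.** For every `A` there are
`ε = ε(A) ∈ (0,1)` and `κ = κ(A) > 0` such that for every SINGULAR KNSS-gauge Type-I field
(`IsTypeIAncientMild C V`, `C ≤ A`) with a Type-I envelope `HasTypeIDecay A V` and every `c > 0`,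
the set of instants `t ∈ [−c², −εc²]` at which some point has `√(−t)‖V(t,x)‖ > 1` has Lebesgue
measure `≥ κ c²`. [folklore (Cavalieri) + KNSS compactness; cite: KochNadirashviliSereginSverak2009, §4 (arXiv:0709.3599 p. 8)] -/
theorem fastTimes_measure_ge (A : ℝ) : ∃ ε : ℝ, 0 < ε ∧ ε < 1 ∧ ∃ κ : ℝ, 0 < κ ∧
    ∀ (C : ℝ) (V : ℝ → EuclideanSpace ℝ (Fin 3) → EuclideanSpace ℝ (Fin 3)),
      IsTypeIAncientMild C V → C ≤ A → HasTypeIDecay A V →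
      (∀ r > 0, ∀ M : ℝ, ∃ t ∈ Ioo (-(r ^ 2)) (0 : ℝ),
        ∃ x ∈ ball (0 : EuclideanSpace ℝ (Fin 3)) r, M < ‖V t x‖) →
      ∀ c : ℝ, 0 < c →
      ENNReal.ofReal (κ * c ^ 2) ≤
        volume {t : ℝ | t ∈ Icc (-c ^ 2) (-(ε * c ^ 2)) ∧ ∃ x, 1 < Real.sqrt (-t) * ‖V t x‖} := by
  obtain ⟨ε, hε, hε1, η, hη, h⟩ := speed_exceeds_one_volume_core A
  set b₃ : ℝ := (volume (ball (0 : EuclideanSpace ℝ (Fin 3)) 1)).toReal with hb₃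
  have hb₃pos : 0 < b₃ :=
    -- (= `…TypeIliouvilleNoTypeII.WeakL3Reach.volume_unitBall_toReal_pos`, inlined to keep imports light)
    ENNReal.toReal_pos (measure_ball_pos volume _ one_pos).ne' measure_ball_lt_top.ne
  -- the constant: `κ = η / ((A−1)³ b₃)` when `A > 1`; for `A ≤ 1` there are no singular members
  rcases le_or_gt A 1 with hA | hA
  · refine ⟨ε, hε, hε1, 1, one_pos, fun C V hV hCA hdec hsing c hc => ?_⟩
    exact absurd (one_lt_of_singular_envelope hV hCA hdec hsing) (not_lt.2 hA)
  have hA1 : 0 < (A - 1) ^ 3 := by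
    have : 0 < A - 1 := by linarith
    positivity
  refine ⟨ε, hε, hε1, η / ((A - 1) ^ 3 * b₃), by positivity, fun C V hV hCA hdec hsing c hc => ?_⟩
  obtain ⟨hcore, hvol⟩ := h C V hV hCA hdec hsing c hc
  set T : Set ℝ := {t : ℝ | t ∈ Icc (-c ^ 2) (-(ε * c ^ 2)) ∧ ∃ x, 1 < Real.sqrt (-t) * ‖V t x‖}
    with hT
  have hsub := subset_times_prod_ball hc hA hcore
  have hR : 0 < (A - 1) * c := by nlinarith
  have key := measure_times_mul_ge hR hsub hvol
  -- `η c⁵ ≤ vol(T) · ((A−1)c)³ b₃`, i.e. `κ c² ≤ vol(T)`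
  have hD : 0 < ((A - 1) * c) ^ 3 * b₃ := by positivity
  have e : η * c ^ 5 = η / ((A - 1) ^ 3 * b₃) * c ^ 2 * (((A - 1) * c) ^ 3 * b₃) := by
    field_simp
  rw [e, ENNReal.ofReal_mul (by positivity)] at key
  have hfin : ENNReal.ofReal (((A - 1) * c) ^ 3 * b₃) ≠ 0 := by
    rw [ne_eq, ENNReal.ofReal_eq_zero, not_le]; exact hD
  exact (ENNReal.mul_le_mul_iff_left hfin ENNReal.ofReal_ne_top).1 key

end FastTimes

end Summit.NavierStokesRegularity.NavierStokesRegularity.Theorems.FiniteDissipationLiouville.WindowRecurrence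

end
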